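import Literature.NumberTheory.Sieve.MaynardSieveCounting
import Literature.NumberTheory.Sieve.MaynardSieveS1
import Literature.NumberTheory.Sieve.CoprimeSquarefreeSumsBounds
import Mathlib.Analysis.SpecialFunctions.Pow.Asymptotics
import HarnessLib

/-!
# Maynard 2015, Lemma 5.1 proved: the named fact `Literature.NumberTheory.Sieve.maynard_lemma51`

J. Maynard, *Small gaps between primes*, Ann. of Math. (2) 181 (2015), 383–413 = arXiv:1311.4600,
Lemma 5.1 (p. 9 of the arXiv text) and its proof (pp. 9–10):
`S₁ = (N/W) Σ_r y_r² / ∏ φ(rᵢ) + O(y_max² φ(W)^k N (log R)^k / (W^{k+1} D₀))`.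

`MaynardSieveCounting.lean` (`Literature.NumberTheory.Sieve.abs_maynardS1_sub_main_le`) gives the inequality
`|S₁ − (N/W) Σ_r y_r²/∏ φ(rᵢ)| ≤ (N/W) F_max² L^k (Z^{k²−k} − 1) + (F_max L^{2k} ⌊R⌋ (1 + log ⌊R⌋)^{k−1})²`
for every `N` (`L = Σ_{n ≤ R, (n,W)=1} μ²(n)/φ(n)`, `Z = Σ μ²(n)/φ(n)²`); this file supplies the
evaluation of the right side for Maynard's parameters `D₀ = ⌊log log log N⌋`, `W = ∏_{p ≤ D₀} p`,
`R = N^{θ/2−δ}` (the last paragraph of the printed proof: "`λ_max ≪ y_max (log R)^k`",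
"`Σ_{u<R} μ²(u)/φ(u) ≪ (φ(W)/W) log R`", "the contribution from `s_{i,j} ≠ 1` is
`≪ y_max² φ(W)^k N (log R)^k/(W^{k+1} D₀)`", and `R² ≤ N^{1−2δ}`):

* `one_div_le_totient_primorial_div` — `φ(W)/W ≥ 1/D₀` (crude Mertens);
* `harmErr_primorial_add_four_le` — the error constant of `CoprimeSquarefreeSums` for `W`: `≤ 13 · 8^{D₀}`;
* `pow_maynardD0_le` — `c^{D₀} ≤ (log log N)^{⌈log c⌉}`; `eventually_mul_log_pow_le_rpow`,
  `eventually_mul_loglog_pow_le_log` — `(log N)^m = o(N^ε)`, `(log log N)^m = o(log N)`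
  (from Mathlib's `isLittleO_log_rpow_rpow_atTop`);
* `lemma51_term1_le`, `lemma51_mainTerm_div_ge`, `lemma51_term2_le` — the real-inequality bookkeeping;
* `maynard_lemma51_holds : maynard_lemma51` — **Lemma 5.1 proved** (`Literature` namespace),
  with `L ≤ (2 + b) (φ(W)/W) log R` (`SquarefreeSums.abs_sum_inv_totient_sub_le`, `b = bConst 2`),
  `Z^{k²−k} − 1 ≤ 4 (k²−k) 3^{k²−k−1}/D₀` (`SquarefreeSums.sum_inv_totient_sq_sub_one_le`,
  `SquarefreeSums.pow_sub_one_le`) and the implied constant `F_max² (2 + b)^k · 4(k²−k)3^{k²−k−1} + 1`.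

After this file the `S₁` half of Prop. 4.1 (`maynard_S1_asymptotic`) rests on `maynard_lemma62_sum`
alone (`maynard_S1_asymptotic_of_lemma62_sum`).

## References

* J. Maynard, *Small gaps between primes*, Ann. of Math. (2) 181 (2015), 383–413,
  doi:10.4007/annals.2015.181.1.7 = arXiv:1311.4600; Lemma 5.1 and its proof, (5.1), (5.9),
  (5.13)–(5.14), pp. 9–10. [cite: MaynardAnnals2015]
-/

open Finset Filter Asymptotics

namespace Literature.NumberTheory.Sieve
namespace MaynardSieve

/-! ### Sizes of `W = ∏_{p ≤ D₀} p`, `φ(W)/W`, `harmErr W` -/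

/-- `∏_{2 ≤ m ≤ D} (1 − 1/m) = 1/D` (`D ≥ 1`, telescoping). [folklore] -/
theorem prod_Icc_one_sub_inv (D : ℕ) (hD : 1 ≤ D) :
    ∏ m ∈ Finset.Icc 2 D, (1 - 1 / (m : ℝ)) = 1 / D := by
  induction D, hD using Nat.le_induction with
  | base => simp
  | succ D hD ih =>
    rw [Finset.prod_Icc_succ_top (by omega), ih]
    have hD' : (0 : ℝ) < D := by exact_mod_cast hD
    field_simp
    push_cast
    ring

/-- **`φ(W)/W ≥ 1/D₀`** for `W = ∏_{p ≤ D₀} p`: `φ(W)/W = ∏_{p ≤ D₀} (1 − 1/p) ≥ ∏_{2 ≤ m ≤ D₀} (1 − 1/m) = 1/D₀`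
(a crude substitute for Mertens' `≍ 1/log D₀`). [folklore] -/
theorem one_div_le_totient_primorial_div {D : ℕ} (hD : 1 ≤ D) :
    1 / (D : ℝ) ≤ (Nat.totient (primorial D) : ℝ) / primorial D := by
  have hW0 : primorial D ≠ 0 := primorial_ne_zero D
  -- `φ(W)/W = ∏_{p ∣ W} (1 − 1/p)`
  have hphi : (Nat.totient (primorial D) : ℝ) / primorial D =
      ∏ p ∈ (primorial D).primeFactors, (1 - 1 / (p : ℝ)) := by
    have h := Nat.totient_mul_prod_primeFactors (primorial D)
    have hP : (0 : ℝ) < ∏ p ∈ (primorial D).primeFactors, (p : ℝ) :=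
      Finset.prod_pos fun p hp => by exact_mod_cast Nat.pos_of_mem_primeFactors hp
    have hW : (0 : ℝ) < primorial D := by exact_mod_cast primorial_pos D
    have h' : (Nat.totient (primorial D) : ℝ) * ∏ p ∈ (primorial D).primeFactors, (p : ℝ) =
        (primorial D : ℝ) * ∏ p ∈ (primorial D).primeFactors, ((p : ℝ) - 1) := by
      have := congrArg (fun n : ℕ => (n : ℝ)) h
      push_cast at this
      rw [this]
      congr 1
      refine Finset.prod_congr rfl fun p hp => ?_
      have := (Nat.prime_of_mem_primeFactors hp).one_le
      push_cast [this]
      ring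
    have hprod : ∏ p ∈ (primorial D).primeFactors, (1 - 1 / (p : ℝ)) =
        (∏ p ∈ (primorial D).primeFactors, ((p : ℝ) - 1)) /
          ∏ p ∈ (primorial D).primeFactors, (p : ℝ) := by
      rw [← Finset.prod_div_distrib]
      refine Finset.prod_congr rfl fun p hp => ?_
      have hp0 : (p : ℝ) ≠ 0 := by exact_mod_cast (Nat.pos_of_mem_primeFactors hp).ne'
      field_simp
    rw [hprod, eq_div_iff hP.ne', div_mul_eq_mul_div, div_eq_iff hW.ne', h', mul_comm]
  rw [hphi, primeFactors_primorial]
  -- compare with the product over all `2 ≤ m ≤ D`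
  have hsub : Nat.primesLE D ⊆ Finset.Icc 2 D := fun p hp => by
    rw [Nat.mem_primesLE] at hp
    exact Finset.mem_Icc.2 ⟨hp.2.two_le, hp.1⟩
  rw [← prod_Icc_one_sub_inv D hD, ← Finset.prod_sdiff hsub]
  have hle1 : ∀ m ∈ Finset.Icc 2 D \ Nat.primesLE D, (1 - 1 / (m : ℝ)) ≤ 1 := fun m _ => by
    have : (0 : ℝ) ≤ 1 / (m : ℝ) := by positivity
    linarith
  have hge0 : ∀ m ∈ Finset.Icc 2 D \ Nat.primesLE D, 0 ≤ (1 - 1 / (m : ℝ)) := fun m hm => by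
    have h2 : (2 : ℝ) ≤ m := by exact_mod_cast (Finset.mem_Icc.1 (Finset.mem_sdiff.1 hm).1).1
    rw [sub_nonneg, div_le_one (by linarith)]; linarith
  have hge0' : 0 ≤ ∏ p ∈ Nat.primesLE D, (1 - 1 / (p : ℝ)) :=
    Finset.prod_nonneg fun p hp => by
      have h2 : (2 : ℝ) ≤ p := by exact_mod_cast (Nat.mem_primesLE.1 hp).2.two_le
      rw [sub_nonneg, div_le_one (by linarith)]; linarith
  calc (∏ m ∈ Finset.Icc 2 D \ Nat.primesLE D, (1 - 1 / (m : ℝ))) *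
        ∏ p ∈ Nat.primesLE D, (1 - 1 / (p : ℝ))
      ≤ 1 * ∏ p ∈ Nat.primesLE D, (1 - 1 / (p : ℝ)) :=
        mul_le_mul_of_nonneg_right (Finset.prod_le_one hge0 hle1) hge0'
    _ = _ := one_mul _

/-- **`harmErr W + 4 ≤ 13 · 8^{D}`** for `W = ∏_{p ≤ D} p` (`D ≥ 1`): `τ(W) ≤ W ≤ 4^D`, `log W ≤ 2D ≤ 2^{D+1}`.
[folklore] -/
theorem harmErr_primorial_add_four_le {D : ℕ} (hD : 1 ≤ D) :
    SquarefreeSums.harmErr (primorial D) + 4 ≤ 13 * 8 ^ D := by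
  unfold SquarefreeSums.harmErr
  have hW4 : (primorial D : ℝ) ≤ 4 ^ D := by exact_mod_cast primorial_le_four_pow D
  have hτ : ((primorial D).divisors.card : ℝ) ≤ 4 ^ D :=
    le_trans (by exact_mod_cast Nat.card_divisors_le_self _) hW4
  have hWpos : (0 : ℝ) < primorial D := by exact_mod_cast primorial_pos D
  have hlog : Real.log (primorial D) ≤ 2 * D := by
    calc Real.log (primorial D) ≤ Real.log ((4 : ℝ) ^ D) := Real.log_le_log hWpos hW4
      _ = D * Real.log 4 := by rw [Real.log_pow]
      _ ≤ D * 2 := by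
          gcongr
          have := Real.log_two_lt_d9
          have h4 : Real.log 4 = 2 * Real.log 2 := by
            rw [show (4 : ℝ) = 2 ^ 2 by norm_num, Real.log_pow]; ring
          rw [h4]; linarith
      _ = 2 * D := by ring
  have hD2 : (D : ℝ) ≤ 2 ^ D := by exact_mod_cast (Nat.lt_two_pow_self).le
  have h8 : (8 : ℝ) ^ D = 4 ^ D * 2 ^ D := by
    rw [show (8 : ℝ) = 4 * 2 by norm_num, mul_pow]
  have h1D : (1 : ℝ) ≤ 2 ^ D := one_le_pow₀ (by norm_num)
  have h14 : (1 : ℝ) ≤ 4 ^ D := one_le_pow₀ (by norm_num)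
  have hlog0 : 0 ≤ Real.log (primorial D) := Real.log_nonneg (by exact_mod_cast primorial_pos D)
  calc 5 * ((primorial D).divisors.card : ℝ) + (((primorial D).divisors.card : ℝ) + 1) *
        Real.log (primorial D) + 4
      ≤ 5 * 4 ^ D + (4 ^ D + 4 ^ D) * (2 * 2 ^ D) + 4 * (4 ^ D * 2 ^ D) := by
        have : (4 : ℝ) ≤ 4 * (4 ^ D * 2 ^ D) := by nlinarith
        have h2 : (((primorial D).divisors.card : ℝ) + 1) * Real.log (primorial D) ≤
            (4 ^ D + 4 ^ D) * (2 * 2 ^ D) :=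
          mul_le_mul (by linarith) (hlog.trans (by nlinarith)) hlog0 (by positivity)
        linarith
    _ = 5 * 4 ^ D + 8 * 8 ^ D := by rw [h8]; ring
    _ ≤ 5 * 8 ^ D + 8 * 8 ^ D := by
        gcongr
        norm_num
    _ = 13 * 8 ^ D := by ring

/-! ### `D₀ = ⌊log log log N⌋`: exponentials in `D₀` are powers of `log log N` -/

/-- For `c ≥ 1` and `log log N ≥ 1`: `c^{D₀} ≤ (log log N)^{⌈log c⌉}` (`D₀ ≤ log log log N`).
[folklore] -/
theorem pow_maynardD0_le {c : ℝ} (hc : 1 ≤ c) {N : ℕ} (hN : 1 ≤ Real.log (Real.log N)) :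
    c ^ maynardD0 N ≤ Real.log (Real.log N) ^ ⌈Real.log c⌉₊ := by
  set ℓ := Real.log (Real.log N) with hℓ
  have hℓ0 : 0 < ℓ := by linarith
  have hlogℓ : 0 ≤ Real.log ℓ := Real.log_nonneg hN
  have hD0 : (maynardD0 N : ℝ) ≤ Real.log ℓ := Nat.floor_le hlogℓ
  have hc0 : 0 < c := by linarith
  have hlogc : 0 ≤ Real.log c := Real.log_nonneg hc
  calc c ^ maynardD0 N = Real.exp (Real.log c) ^ maynardD0 N := by rw [Real.exp_log hc0]
    _ = Real.exp ((maynardD0 N : ℝ) * Real.log c) := by rw [← Real.exp_nat_mul]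
    _ ≤ Real.exp (Real.log ℓ * Real.log c) := by gcongr
    _ = ℓ ^ (Real.log c) := by rw [Real.rpow_def_of_pos hℓ0]
    _ ≤ ℓ ^ ((⌈Real.log c⌉₊ : ℕ) : ℝ) := Real.rpow_le_rpow_of_exponent_le hN (Nat.le_ceil _)
    _ = ℓ ^ ⌈Real.log c⌉₊ := Real.rpow_natCast ℓ _

/-- `D₀ ≤ log log N` once `log log N ≥ 1` (`⌊log x⌋ ≤ log x ≤ x`). [folklore] -/
theorem maynardD0_le_loglog {N : ℕ} (hN : 1 ≤ Real.log (Real.log N)) :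
    (maynardD0 N : ℝ) ≤ Real.log (Real.log N) :=
  (Nat.floor_le (Real.log_nonneg hN)).trans (Real.log_le_self (by linarith))

/-! ### The two growth comparisons -/

/-- `C (log N)^m ≤ N^ε` eventually (`ε > 0`). [folklore] -/
theorem eventually_mul_log_pow_le_rpow (C : ℝ) (m : ℕ) {ε : ℝ} (hε : 0 < ε) :
    ∀ᶠ N : ℕ in atTop, C * Real.log N ^ m ≤ (N : ℝ) ^ ε := by
  have h := (isLittleO_log_rpow_rpow_atTop (m : ℝ) hε).comp_tendsto tendsto_natCast_atTop_atTop
  have hc : (0 : ℝ) < 1 / (|C| + 1) := by positivity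
  filter_upwards [h.bound hc, eventually_ge_atTop 1] with N hN hN1
  simp only [Function.comp, Real.rpow_natCast] at hN
  have hlog : 0 ≤ Real.log N := Real.log_nonneg (by exact_mod_cast hN1)
  have hNε : 0 ≤ (N : ℝ) ^ ε := by positivity
  rw [Real.norm_of_nonneg (by positivity), Real.norm_of_nonneg hNε] at hN
  calc C * Real.log N ^ m ≤ |C| * Real.log N ^ m := by gcongr; exact le_abs_self C
    _ ≤ |C| * (1 / (|C| + 1) * (N : ℝ) ^ ε) := by gcongr
    _ = |C| / (|C| + 1) * (N : ℝ) ^ ε := by ring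
    _ ≤ 1 * (N : ℝ) ^ ε := by
        gcongr
        rw [div_le_one (by positivity)]; linarith
    _ = _ := one_mul _

/-- `C (log log N)^m ≤ c log N` eventually (`c > 0`). [folklore] -/
theorem eventually_mul_loglog_pow_le_log (C : ℝ) (m : ℕ) {c : ℝ} (hc : 0 < c) :
    ∀ᶠ N : ℕ in atTop, C * Real.log (Real.log N) ^ m ≤ c * Real.log N := by
  have h := (isLittleO_log_rpow_rpow_atTop (m : ℝ) one_pos).comp_tendsto
    (Real.tendsto_log_atTop.comp tendsto_natCast_atTop_atTop)
  have hc' : (0 : ℝ) < c / (|C| + 1) := by positivity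
  have hev : ∀ᶠ N : ℕ in atTop, 1 ≤ Real.log N :=
    (Real.tendsto_log_atTop.comp tendsto_natCast_atTop_atTop).eventually_ge_atTop 1
  filter_upwards [h.bound hc', hev] with N hN hN1
  simp only [Function.comp, Real.rpow_natCast, Real.rpow_one] at hN
  have hlog : 0 ≤ Real.log (Real.log N) := Real.log_nonneg hN1
  rw [Real.norm_of_nonneg (by positivity), Real.norm_of_nonneg (by linarith)] at hN
  calc C * Real.log (Real.log N) ^ m ≤ |C| * Real.log (Real.log N) ^ m := by
        gcongr; exact le_abs_self C
    _ ≤ |C| * (c / (|C| + 1) * Real.log N) := by gcongr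
    _ = |C| / (|C| + 1) * (c * Real.log N) := by ring
    _ ≤ 1 * (c * Real.log N) := by
        gcongr
        rw [div_le_one (by positivity)]; linarith
    _ = _ := one_mul _

/-! ### Eventual properties of `D₀(N)`, `R(N)` -/

/-- `D₀(N) → ∞` as naturals (from `tendsto_maynardD0_atTop`, the real-valued form). [folklore] -/
theorem tendsto_maynardD0_atTop' : Tendsto maynardD0 atTop atTop :=
  tendsto_natCast_atTop_iff.1 tendsto_maynardD0_atTop

/-- `log log N ≥ 1` eventually. [folklore] -/
theorem eventually_one_le_loglog : ∀ᶠ N : ℕ in atTop, 1 ≤ Real.log (Real.log N) :=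
  (Real.tendsto_log_atTop.comp (Real.tendsto_log_atTop.comp
    tendsto_natCast_atTop_atTop)).eventually_ge_atTop 1

/-- `R = N^{θ/2−δ} ≥ 2` eventually (`θ/2 − δ > 0`). [folklore] -/
theorem eventually_two_le_maynardR {θ δ : ℝ} (h : 0 < θ / 2 - δ) :
    ∀ᶠ N : ℕ in atTop, 2 ≤ maynardR θ δ N :=
  ((tendsto_rpow_atTop h).comp tendsto_natCast_atTop_atTop).eventually_ge_atTop 2

/-! ### Lemma 5.1 assembled: the named fact `maynard_lemma51` -/

/-- `(N/W) · ((φ(W)/W) log R)^k = maynardMainTerm` (cf. `div_mul_maynardSumScale`). [folklore] -/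
theorem div_mul_pow_eq_maynardMainTerm (k : ℕ) (θ δ : ℝ) (N : ℕ) :
    (N : ℝ) / (maynardW N) *
        ((Nat.totient (maynardW N) : ℝ) / (maynardW N) * Real.log (maynardR θ δ N)) ^ k =
      maynardMainTerm k θ δ N := by
  rw [← div_mul_maynardSumScale k θ δ N, maynardSumScale, mul_pow, div_pow]
  ring

/-- `⌈log 16⌉ ≤ 3` (`log 2 < 0.6931471808`). [folklore] -/
theorem natCeil_log_sixteen_le : ⌈Real.log 16⌉₊ ≤ 3 := by
  rw [Nat.ceil_le]
  have h : Real.log 16 = 4 * Real.log 2 := by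
    rw [show (16 : ℝ) = 2 ^ 4 by norm_num, Real.log_pow]; ring
  rw [h]
  have := Real.log_two_lt_d9
  push_cast
  linarith

/-- Bookkeeping for the first error term of Lemma 5.1:
`(N/W) y_max² L^k (Z^K − 1) ≤ y_max² C_L^k C_Z · ((N/W) P^k / D)` when `L ≤ C_L P`, `Z^K − 1 ≤ C_Z/D`.
[folklore] -/
theorem lemma51_term1_le {N W D P L Z Gmax CL CZ : ℝ} {k K : ℕ}
    (hW : 0 < W) (hN : 0 ≤ N) (hL0 : 0 ≤ L) (hL : L ≤ CL * P)
    (hZ1 : 1 ≤ Z) (hZK : Z ^ K - 1 ≤ CZ / D) :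
    N / W * (Gmax ^ 2 * L ^ k * (Z ^ K - 1)) ≤ Gmax ^ 2 * CL ^ k * CZ * (N / W * P ^ k / D) := by
  have hZK0 : 0 ≤ Z ^ K - 1 := by linarith [one_le_pow₀ (M₀ := ℝ) hZ1 (n := K)]
  have hCLP : 0 ≤ CL * P := hL0.trans hL
  calc N / W * (Gmax ^ 2 * L ^ k * (Z ^ K - 1))
      ≤ N / W * (Gmax ^ 2 * (CL * P) ^ k * (CZ / D)) := by gcongr
    _ = Gmax ^ 2 * CL ^ k * CZ * (N / W * P ^ k / D) := by rw [mul_pow]; ring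

/-- Bookkeeping for the size of the main term:
`N η^k / (log N)^m ≤ (N/W) (φ_W η log N)^k / D` when `φ_W ≥ 1/D`, `W D^{k+1} ≤ (log N)^m`, `log N ≥ 1`.
[folklore] -/
theorem lemma51_mainTerm_div_ge {N W D φW logN η : ℝ} {k m : ℕ} (hN : 0 ≤ N) (hW : 0 < W)
    (hD : 0 < D) (hη : 0 < η) (hlogN : 1 ≤ logN) (hφ : 1 / D ≤ φW)
    (hWD : W * D ^ (k + 1) ≤ logN ^ m) :
    N * η ^ k / logN ^ m ≤ N / W * (φW * (η * logN)) ^ k / D := by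
  have hlogm : 0 < logN ^ m := by positivity
  have hstep1 : N * η ^ k / logN ^ m ≤ N * η ^ k / (W * D ^ (k + 1)) :=
    div_le_div_of_nonneg_left (by positivity) (by positivity) hWD
  refine hstep1.trans ?_
  have hlogk : (1 : ℝ) ≤ logN ^ k := one_le_pow₀ hlogN
  have hDk : (0 : ℝ) < D ^ k := by positivity
  calc N * η ^ k / (W * D ^ (k + 1))
      ≤ N * η ^ k * logN ^ k / (W * D ^ (k + 1)) :=
        div_le_div_of_nonneg_right (le_mul_of_one_le_right (by positivity) hlogk) (by positivity)
    _ = N / W * ((1 / D) * (η * logN)) ^ k / D := by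
        rw [mul_pow, mul_pow, div_pow, one_pow, pow_succ]
        field_simp
    _ ≤ N / W * (φW * (η * logN)) ^ k / D := by gcongr

/-- Bookkeeping for the second error term of Lemma 5.1:
`(y_max L^{2k} B (1 + log B)^{k−1})² ≤ N η^k/(log N)^m` when `L ≤ C_L log N`, `B ≤ N^η`,
`1 + log B ≤ 2 log N`, `2η ≤ 1 − 2δ` and `A (log N)^{6k+m} ≤ N^{2δ}` with
`A = y_max² C_L^{4k} 4^k / η^k`. [folklore] -/
theorem lemma51_term2_le {N logN η δ Gmax CL L B A : ℝ} {k m : ℕ}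
    (hN : 0 < N) (hN1 : 1 ≤ N) (hlogN : 1 ≤ logN) (hη : 0 < η) (hG : 0 ≤ Gmax) (hCL : 0 ≤ CL)
    (hL0 : 0 ≤ L) (hL : L ≤ CL * logN) (hB0 : 0 ≤ B) (hB : B ≤ N ^ η)
    (hlogB : 1 + Real.log B ≤ 2 * logN) (hlogB0 : 0 ≤ 1 + Real.log B) (hηδ : 2 * η ≤ 1 - 2 * δ)
    (hA : A = Gmax ^ 2 * CL ^ (4 * k) * 4 ^ k / η ^ k) (hE4 : A * logN ^ (6 * k + m) ≤ N ^ (2 * δ)) :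
    (Gmax * L ^ (2 * k) * (B * (1 + Real.log B) ^ (k - 1))) ^ 2 ≤ N * η ^ k / logN ^ m := by
  have hlogN0 : 0 ≤ logN := by linarith
  have hinner : Gmax * L ^ (2 * k) * (B * (1 + Real.log B) ^ (k - 1)) ≤
      Gmax * (CL * logN) ^ (2 * k) * (N ^ η * (2 * logN) ^ (k - 1)) := by gcongr
  have hinner0 : 0 ≤ Gmax * L ^ (2 * k) * (B * (1 + Real.log B) ^ (k - 1)) := by positivity
  have hmaj : Gmax * (CL * logN) ^ (2 * k) * (N ^ η * (2 * logN) ^ (k - 1)) ≤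
      Gmax * CL ^ (2 * k) * 2 ^ k * logN ^ (3 * k) * N ^ η := by
    have hlk : logN ^ (2 * k) * logN ^ (k - 1) ≤ logN ^ (3 * k) := by
      rw [← pow_add]; exact pow_le_pow_right₀ hlogN (by omega)
    have h2k : (2 : ℝ) ^ (k - 1) ≤ 2 ^ k := pow_le_pow_right₀ (by norm_num) (by omega)
    calc Gmax * (CL * logN) ^ (2 * k) * (N ^ η * (2 * logN) ^ (k - 1))
        = Gmax * CL ^ (2 * k) * 2 ^ (k - 1) * (logN ^ (2 * k) * logN ^ (k - 1)) * N ^ η := by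
          rw [mul_pow, mul_pow]; ring
      _ ≤ Gmax * CL ^ (2 * k) * 2 ^ k * logN ^ (3 * k) * N ^ η := by gcongr
  have hsq := pow_le_pow_left₀ hinner0 (hinner.trans hmaj) 2
  refine hsq.trans ?_
  have hN2η : (N ^ η) ^ 2 ≤ N ^ (1 - 2 * δ) := by
    rw [← Real.rpow_natCast, ← Real.rpow_mul hN.le]
    refine Real.rpow_le_rpow_of_exponent_le hN1 ?_
    push_cast; linarith
  have hηk : η ^ k ≠ 0 := by positivity
  have hlogm : logN ^ m ≠ 0 := by positivity
  have hNN : N ^ (2 * δ) * N ^ (1 - 2 * δ) = N := by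
    rw [← Real.rpow_add hN, show 2 * δ + (1 - 2 * δ) = (1 : ℝ) by ring, Real.rpow_one]
  calc (Gmax * CL ^ (2 * k) * 2 ^ k * logN ^ (3 * k) * N ^ η) ^ 2
      = Gmax ^ 2 * CL ^ (4 * k) * 4 ^ k * logN ^ (6 * k) * (N ^ η) ^ 2 := by
        have e1 : (CL ^ (2 * k)) ^ 2 = CL ^ (4 * k) := by rw [← pow_mul]; congr 1; ring
        have e2 : ((2 : ℝ) ^ k) ^ 2 = 4 ^ k := by
          rw [← pow_mul, show (4 : ℝ) = 2 ^ 2 by norm_num, ← pow_mul]; congr 1; ring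
        have e3 : (logN ^ (3 * k)) ^ 2 = logN ^ (6 * k) := by rw [← pow_mul]; congr 1; ring
        rw [mul_pow, mul_pow, mul_pow, mul_pow, e1, e2, e3]
    _ ≤ Gmax ^ 2 * CL ^ (4 * k) * 4 ^ k * logN ^ (6 * k) * N ^ (1 - 2 * δ) := by gcongr
    _ = (A * logN ^ (6 * k + m)) * (η ^ k * N ^ (1 - 2 * δ) / logN ^ m) := by
        rw [hA, pow_add]; field_simp
    _ ≤ N ^ (2 * δ) * (η ^ k * N ^ (1 - 2 * δ) / logN ^ m) := by gcongr
    _ = N * η ^ k / logN ^ m := by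
        rw [mul_div_assoc', mul_left_comm, hNN]; ring

end MaynardSieve

open MaynardSieve in
/-- **Maynard 2015, Lemma 5.1** — the named fact `Literature.NumberTheory.Sieve.maynard_lemma51` of `MaynardSieveS1.lean`,
PROVED: `S₁ − (N/W) Σ_r y_r²/∏ φ(rᵢ) = O(φ(W)^k N (log R)^k / (W^{k+1} D₀))` for the weights of
Prop. 4.1 with `F = G · 1_{R_k}`, `G` continuous, distinct shifts, `0 < δ`, `0 < θ/2 − δ`, `θ ≤ 1`.
Assembly of `abs_maynardS1_sub_main_le` (display (5.1) + the diagonalisation (5.2)–(5.7)) with the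
evaluations `L ≤ (2 + b) (φ(W)/W) log R` (`SquarefreeSums.abs_sum_inv_totient_sub_le`),
`Z^{k²−k} − 1 ≤ 4 (k² − k) 3^{k²−k−1}/D₀` (`SquarefreeSums.sum_inv_totient_sq_sub_one_le`), and
`R² (log R)^{O(k)} ≤ 𝔐/D₀` eventually (powers of `log N`, resp. of `log log N` for the factors
`W ≤ 4^{D₀}`, `D₀^{k+1}`, against `N^{2δ}`). [cite: MaynardAnnals2015, Lemma 5.1] -/
theorem maynard_lemma51_holds : maynard_lemma51 := by
  intro k hk h hinj θ δ hδ hη hθ1 G hG v₀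
  classical
  -- `G` is bounded on the simplex
  obtain ⟨Gmax, hG0, hGmax⟩ : ∃ M : ℝ, 0 ≤ M ∧ ∀ x ∈ maynardSimplex k, |G x| ≤ M := by
    obtain ⟨M, hM⟩ := (isCompact_maynardSimplex k).exists_bound_of_continuousOn hG.continuousOn
    exact ⟨max M 0, le_max_right _ _, fun x hx => (hM x hx).trans (le_max_left _ _)⟩
  -- the shifts: `Hmax ≥ |hᵢ − hⱼ|`
  obtain ⟨Hmax, hHmax⟩ : ∃ H : ℕ, ∀ i j, (h i - h j).natAbs ≤ H :=
    ⟨Finset.univ.sup fun p : Fin k × Fin k => (h p.1 - h p.2).natAbs, fun i j =>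
      Finset.le_sup (f := fun p : Fin k × Fin k => (h p.1 - h p.2).natAbs) (Finset.mem_univ (i, j))⟩
  have hb0 : 0 < SquarefreeSums.bConst 2 := by unfold SquarefreeSums.bConst; positivity
  -- constants (opaque names)
  obtain ⟨K, hK⟩ : ∃ K : ℕ, K = Fintype.card (OffDiag k) := ⟨_, rfl⟩
  obtain ⟨CL, hCL⟩ : ∃ C : ℝ, C = 2 + SquarefreeSums.bConst 2 := ⟨_, rfl⟩
  obtain ⟨CZ, hCZ⟩ : ∃ C : ℝ, C = 4 * K * 3 ^ (K - 1) := ⟨_, rfl⟩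
  obtain ⟨m₂, hm₂⟩ : ∃ m : ℕ, m = ⌈Real.log ((2 : ℝ) ^ (k + 3))⌉₊ := ⟨_, rfl⟩
  obtain ⟨A, hA⟩ : ∃ A : ℝ, A = Gmax ^ 2 * CL ^ (4 * k) * 4 ^ k / (θ / 2 - δ) ^ k := ⟨_, rfl⟩
  have hCL0 : 0 ≤ CL := by rw [hCL]; positivity
  have hCZ0 : 0 ≤ CZ := by rw [hCZ]; positivity
  refine Asymptotics.IsBigO.of_bound (Gmax ^ 2 * CL ^ k * CZ + 1) ?_
  filter_upwards [eventually_one_le_loglog, tendsto_maynardD0_atTop'.eventually_ge_atTop (max 3 Hmax),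
    eventually_two_le_maynardR hη,
    eventually_mul_loglog_pow_le_log (13 * SquarefreeSums.bConst 2) 3 hη,
    eventually_mul_log_pow_le_rpow A (6 * k + m₂) (by positivity : (0 : ℝ) < 2 * δ),
    (Real.tendsto_log_atTop.comp tendsto_natCast_atTop_atTop).eventually_ge_atTop 1,
    eventually_ge_atTop 1] with N hll hD0 hR2 hE3 hE4 hlogN' hN1
  have hlogN : 1 ≤ Real.log N := hlogN'
  -- basic facts on `D₀, W, R, B = ⌊R⌋`
  have hD3 : 3 ≤ maynardD0 N := le_of_max_le_left hD0
  have hDH : Hmax ≤ maynardD0 N := le_of_max_le_right hD0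
  have hD1 : 1 ≤ maynardD0 N := by omega
  have hDr : (3 : ℝ) ≤ maynardD0 N := by exact_mod_cast hD3
  have hDpos : (0 : ℝ) < maynardD0 N := by linarith
  have hW0 : maynardW N ≠ 0 := primorial_ne_zero _
  have hWpos : (0 : ℝ) < maynardW N := by exact_mod_cast primorial_pos _
  have hDW : ∀ p, p.Prime → p ≤ maynardD0 N → p ∣ maynardW N := fun p hp hpD =>
    (Nat.Prime.dvd_primorial_iff hp).2 hpD
  have hR1 : 1 < maynardR θ δ N := by linarith
  have hRpos : 0 < maynardR θ δ N := by linarith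
  have hB1 : 1 ≤ ⌊maynardR θ δ N⌋₊ := Nat.le_floor (by simp only [Nat.cast_one]; linarith)
  have hBR : (⌊maynardR θ δ N⌋₊ : ℝ) ≤ maynardR θ δ N := Nat.floor_le hRpos.le
  have hB1r : (1 : ℝ) ≤ ⌊maynardR θ δ N⌋₊ := by exact_mod_cast hB1
  have hNpos : (0 : ℝ) < N := by exact_mod_cast hN1
  have hN1r : (1 : ℝ) ≤ N := by exact_mod_cast hN1
  have hlogR : Real.log (maynardR θ δ N) = (θ / 2 - δ) * Real.log N := by
    rw [maynardR, Real.log_rpow hNpos]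
  have hlogRle : Real.log (maynardR θ δ N) ≤ Real.log N := by
    rw [hlogR]; exact mul_le_of_le_one_left (by linarith) (by linarith)
  have hlogR0 : 0 < Real.log (maynardR θ δ N) := Real.log_pos hR1
  have hlogB : Real.log ⌊maynardR θ δ N⌋₊ ≤ Real.log (maynardR θ δ N) :=
    Real.log_le_log (by linarith) hBR
  have hlogB0 : 0 ≤ Real.log ⌊maynardR θ δ N⌋₊ := Real.log_nonneg hB1r
  -- the hypothesis on the shifts
  have hh : ∀ i j, i ≠ j → ∀ p : ℕ, p.Prime → (p : ℤ) ∣ h i - h j → p ∣ maynardW N := by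
    intro i j hij p hp hpd
    refine hDW p hp (le_trans ?_ hDH)
    have hne : h i - h j ≠ 0 := sub_ne_zero.2 fun he => hij (hinj he)
    have h1 : p ∣ (h i - h j).natAbs := Int.natCast_dvd.1 hpd
    exact (Nat.le_of_dvd (Int.natAbs_pos.2 hne) h1).trans (hHmax i j)
  -- the combinatorial Lemma 5.1
  have hmain := abs_maynardS1_sub_main_le hk h G hR1 hW0 hG0 hGmax hh (v₀ N) N
  obtain ⟨L, hLdef⟩ : ∃ L : ℝ, L = ∑ n ∈ G1 (maynardW N) ⌊maynardR θ δ N⌋₊, 1 / (n.totient : ℝ) :=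
    ⟨_, rfl⟩
  obtain ⟨Z, hZdef⟩ : ∃ Z : ℝ,
      Z = ∑ n ∈ G1 (maynardW N) ⌊maynardR θ δ N⌋₊, 1 / (n.totient : ℝ) ^ 2 := ⟨_, rfl⟩
  obtain ⟨φW, hφW⟩ : ∃ x : ℝ, x = (Nat.totient (maynardW N) : ℝ) / maynardW N := ⟨_, rfl⟩
  rw [← hLdef, ← hZdef, ← hK] at hmain
  have hφW0 : 0 ≤ φW := by rw [hφW]; positivity
  have hφW1 : φW ≤ 1 := by
    rw [hφW, div_le_one hWpos]; exact_mod_cast Nat.totient_le _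
  have hφWD : 1 / (maynardD0 N : ℝ) ≤ φW := hφW ▸ one_div_le_totient_primorial_div hD1
  have hL0 : 0 ≤ L := by rw [hLdef]; exact Finset.sum_nonneg fun _ _ => by positivity
  -- `Z ≥ 1` and `Z^K − 1 ≤ CZ/D₀`
  have h1G1 : 1 ∈ G1 (maynardW N) ⌊maynardR θ δ N⌋₊ := by
    rw [mem_G1]; exact ⟨⟨le_rfl, hB1⟩, squarefree_one, Nat.coprime_one_left _⟩
  have hZ1 : 1 ≤ Z := by
    have := Finset.single_le_sum (f := fun n : ℕ => 1 / (n.totient : ℝ) ^ 2)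
      (fun _ _ => by positivity) h1G1
    rw [← hZdef, Nat.totient_one, Nat.cast_one, one_pow, div_one] at this
    exact this
  have hZK : Z ^ K - 1 ≤ CZ / maynardD0 N := by
    have hZsub : Z - 1 ≤ 4 / maynardD0 N := by
      have h := SquarefreeSums.sum_inv_totient_sq_sub_one_le (W := maynardW N) (D₀ := maynardD0 N)
        (by omega) hDW ⌊maynardR θ δ N⌋₊
      rw [← G1, ← hZdef] at h
      have h' : 2 / ((maynardD0 N : ℝ) - 1) ≤ 4 / maynardD0 N := by
        rw [div_le_div_iff₀ (by linarith) hDpos]; linarith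
      exact h.trans h'
    have hZ3 : Z ≤ 3 := by
      have : (4 : ℝ) / maynardD0 N ≤ 2 := by rw [div_le_iff₀ hDpos]; linarith
      linarith
    have hZ0 : 0 ≤ Z - 1 := by linarith
    calc Z ^ K - 1 ≤ K * (Z - 1) * Z ^ (K - 1) := SquarefreeSums.pow_sub_one_le hZ1 K
      _ ≤ K * (4 / maynardD0 N) * 3 ^ (K - 1) := by gcongr
      _ = CZ / maynardD0 N := by rw [hCZ]; ring
  -- `E3`: `(harmErr W + 4) b ≤ φ_W log R`, via `13 b 16^{D₀} ≤ 13 b (log log N)^3 ≤ η log N`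
  have hE3' : (SquarefreeSums.harmErr (maynardW N) + 4) * SquarefreeSums.bConst 2 ≤
      φW * Real.log (maynardR θ δ N) := by
    have h16 : (16 : ℝ) ^ maynardD0 N ≤ Real.log (Real.log N) ^ 3 :=
      (pow_maynardD0_le (c := 16) (by norm_num) hll).trans
        (pow_le_pow_right₀ hll natCeil_log_sixteen_le)
    have hharm := harmErr_primorial_add_four_le hD1
    have hD2D : (maynardD0 N : ℝ) ≤ 2 ^ maynardD0 N := by exact_mod_cast (Nat.lt_two_pow_self).le
    have hharm0 : 0 ≤ SquarefreeSums.harmErr (maynardW N) + 4 := by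
      unfold SquarefreeSums.harmErr
      have : 0 ≤ Real.log (maynardW N) := Real.log_nonneg (by exact_mod_cast primorial_pos _)
      positivity
    have key : (SquarefreeSums.harmErr (maynardW N) + 4) * SquarefreeSums.bConst 2 * maynardD0 N ≤
        Real.log (maynardR θ δ N) := by
      calc (SquarefreeSums.harmErr (maynardW N) + 4) * SquarefreeSums.bConst 2 * maynardD0 N
          ≤ (13 * 8 ^ maynardD0 N) * SquarefreeSums.bConst 2 * 2 ^ maynardD0 N := by
            gcongr; exact hharm
        _ = 13 * SquarefreeSums.bConst 2 * 16 ^ maynardD0 N := by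
            rw [show (16 : ℝ) = 8 * 2 by norm_num, mul_pow]; ring
        _ ≤ 13 * SquarefreeSums.bConst 2 * Real.log (Real.log N) ^ 3 := by gcongr
        _ ≤ (θ / 2 - δ) * Real.log N := hE3
        _ = Real.log (maynardR θ δ N) := hlogR.symm
    calc (SquarefreeSums.harmErr (maynardW N) + 4) * SquarefreeSums.bConst 2
        = (SquarefreeSums.harmErr (maynardW N) + 4) * SquarefreeSums.bConst 2 * maynardD0 N *
            (1 / maynardD0 N) := by field_simp
      _ ≤ Real.log (maynardR θ δ N) * φW := mul_le_mul key hφWD (by positivity) hlogR0.le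
      _ = φW * Real.log (maynardR θ δ N) := mul_comm _ _
  -- `L ≤ CL φ_W log R`
  have hL : L ≤ CL * (φW * Real.log (maynardR θ δ N)) := by
    have h := SquarefreeSums.abs_sum_inv_totient_sub_le hW0 hD1 hDW hB1
    rw [← G1, ← hLdef, ← hφW] at h
    have h' := (abs_sub_le_iff.1 h).1
    have hD14 : (maynardD0 N : ℝ) ^ (-(1 : ℝ) / 4) ≤ 1 :=
      Real.rpow_le_one_of_one_le_of_nonpos (by linarith) (by norm_num)
    have hb := hb0.le
    calc L ≤ φW * Real.log ⌊maynardR θ δ N⌋₊ +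
          ((SquarefreeSums.harmErr (maynardW N) + 4) * SquarefreeSums.bConst 2 +
            φW * (SquarefreeSums.bConst 2 * (maynardD0 N : ℝ) ^ (-(1 : ℝ) / 4)) *
              Real.log ⌊maynardR θ δ N⌋₊) := by linarith
      _ ≤ φW * Real.log (maynardR θ δ N) + (φW * Real.log (maynardR θ δ N) +
          φW * (SquarefreeSums.bConst 2 * 1) * Real.log (maynardR θ δ N)) := by gcongr
      _ = CL * (φW * Real.log (maynardR θ δ N)) := by rw [hCL]; ring
  have hP0 : 0 ≤ φW * Real.log (maynardR θ δ N) := by positivity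
  -- the main term
  have hMT : (N : ℝ) / maynardW N * (φW * Real.log (maynardR θ δ N)) ^ k = maynardMainTerm k θ δ N := by
    rw [hφW]; exact div_mul_pow_eq_maynardMainTerm k θ δ N
  have hMT0 : 0 ≤ maynardMainTerm k θ δ N := by rw [← hMT]; positivity
  have hMTD0 : 0 ≤ maynardMainTerm k θ δ N / maynardD0 N := by positivity
  -- term 1
  have hT1 := lemma51_term1_le (Gmax := Gmax) (k := k) hWpos hNpos.le hL0 hL hZ1 hZK
  rw [hMT] at hT1
  -- lower bound for `MT/D₀`
  have hWD : (maynardW N : ℝ) * (maynardD0 N : ℝ) ^ (k + 1) ≤ Real.log N ^ m₂ := by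
    have hW4 : (maynardW N : ℝ) ≤ 4 ^ maynardD0 N := by exact_mod_cast primorial_le_four_pow _
    have hD2D : (maynardD0 N : ℝ) ≤ 2 ^ maynardD0 N := by exact_mod_cast (Nat.lt_two_pow_self).le
    have h2D : ((2 : ℝ) ^ (k + 3)) ^ maynardD0 N ≤ Real.log N ^ m₂ := by
      have h1 := pow_maynardD0_le (c := (2 : ℝ) ^ (k + 3)) (one_le_pow₀ (by norm_num)) hll
      rw [← hm₂] at h1
      exact h1.trans (pow_le_pow_left₀ (by linarith) (Real.log_le_self (by linarith)) m₂)
    calc (maynardW N : ℝ) * (maynardD0 N : ℝ) ^ (k + 1)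
        ≤ 4 ^ maynardD0 N * (2 ^ maynardD0 N) ^ (k + 1) := by gcongr
      _ = ((2 : ℝ) ^ (k + 3)) ^ maynardD0 N := by
          rw [← pow_mul, ← pow_mul, show (4 : ℝ) = 2 ^ 2 by norm_num, ← pow_mul, ← pow_add]
          congr 1; ring
      _ ≤ Real.log N ^ m₂ := h2D
  have hMTlow := lemma51_mainTerm_div_ge (k := k) hNpos.le hWpos hDpos hη hlogN hφWD hWD
  rw [← hlogR, hMT] at hMTlow
  -- term 2
  have hL' : L ≤ CL * Real.log N := by
    refine hL.trans ?_
    calc CL * (φW * Real.log (maynardR θ δ N)) ≤ CL * (1 * Real.log N) := by gcongr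
      _ = CL * Real.log N := by rw [one_mul]
  have hBN : (⌊maynardR θ δ N⌋₊ : ℝ) ≤ (N : ℝ) ^ (θ / 2 - δ) := hBR
  have h1B : 1 + Real.log ⌊maynardR θ δ N⌋₊ ≤ 2 * Real.log N := by linarith [hlogB.trans hlogRle]
  have h1B0 : 0 ≤ 1 + Real.log ⌊maynardR θ δ N⌋₊ := by linarith
  have hηδ : 2 * (θ / 2 - δ) ≤ 1 - 2 * δ := by linarith
  have hT2 := lemma51_term2_le (k := k) (m := m₂) hNpos hN1r hlogN hη hG0 hCL0 hL0 hL'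
    (Nat.cast_nonneg _) hBN h1B h1B0 hηδ hA hE4
  -- conclusion
  rw [Real.norm_eq_abs, Real.norm_eq_abs, abs_of_nonneg hMTD0]
  calc _ ≤ _ := hmain
    _ ≤ Gmax ^ 2 * CL ^ k * CZ * (maynardMainTerm k θ δ N / maynardD0 N) +
          maynardMainTerm k θ δ N / maynardD0 N := add_le_add hT1 (hT2.trans hMTlow)
    _ = (Gmax ^ 2 * CL ^ k * CZ + 1) * (maynardMainTerm k θ δ N / maynardD0 N) := by ring

/-- After Lemma 5.1, the `S₁` half of Prop. 4.1 (`maynard_S1_asymptotic` = Lemma 6.2) rests on the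
smooth-sum evaluation `maynard_lemma62_sum` ((6.4)–(6.7)) alone. [cite: MaynardAnnals2015, Lemma 6.2] -/
theorem maynard_S1_asymptotic_of_lemma62_sum (h62 : maynard_lemma62_sum) : maynard_S1_asymptotic :=
  maynard_S1_asymptotic_of maynard_lemma51_holds h62

end Literature.NumberTheory.Sieve
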